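import Summits.NavierStokesRegularity.OSWSelfSimilar.SheetRTimeShiftModeAssembly
import Summits.NavierStokesRegularity.OSWSelfSimilar.SheetRCertificateAssembly
import HarnessLib

/-!
# SHEET-ℝ: (P6) of the Z3-SR-SPEC spectral certificate TRANSPORTED into the weak language of the S2 kernel assembly, part 1 —
# STRONG ⇒ WEAK for the linearised equation: the time-shift mode `v = Ω* + ½ξΩ*′` solves
# `linForm L (drift a Ω*) (potential L λ Ω*) v v′ φ φ₁ − ∫ w·(P_{Ω*}v)·φ = −∫ w·v·φ` on every compactly supported test

HONEST FRAMING (cell ns-blowup GROUP B / zone Z3, case Z3-SR-SPEC, P-list item (P6) «`σ = 1` is an eigenvalue with eigenvector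
`Ω* + ½ξΩ*′ ∈ E`» as the HYPOTHESIS `IsWeakEigen … 1 u` / `IsWeakImage` of the S2 kernel assembly (selfsim g12 `SheetREvansOdd`,
`SheetRGeneratorOddWeak`, `SheetRSpectrumOddAssembly`; cert-2 g7 `SheetRSpectrumWindingAssembly`); 1-D MODEL certificate frame (viscous gCLM/OSW
sheet on the line, `ν = 1`); not Euler/NS; «violates: none — MODEL»). Nothing here asserts that a profile exists: `Ω*` enters through its STRONG
consequences (`v ∈ C²` + the pointwise linearised identity, = the conclusions of cert-5 g5's `SheetRTimeShiftModeAssembly.timeShiftMode_eigen_and_energy`).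
CONTENT.
* §1 `integral_deriv_mul_test` — one absolutely continuous integration by parts `∫ g′·φ = −∫ g·φ₁` for `g ∈ C¹` and a compactly
  supported test `(φ, φ₁)` (`IsCompactTest`: `φ = ∫₀φ₁`, `φ₁ ∈ L²`).
* §2 `exists_esp_of_profile` — an odd energy-class profile `v = ∫₀v₁` (finite weights) IS an element `P` of selfsim's energy space
  `Esp L hL` with `prim (der P) = v`, `der P = v₁` a.e. (the read-backs the weak language is written in); `esp_ne_zero_of_apply_ne_zero`.
* §3 `linForm_sub_pop_eq_of_strong` — STRONG ⇒ WEAK: if `v ∈ C²` satisfies the pointwise linearised equation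
  `v + ½ξv′ + a(𝒰_v·Ω′ + 𝒰_Ω·v′) − Hv·Ω − HΩ·v − v″ = −v` (`𝒰_f = ∫₀Hf`), then for every compactly supported test
  `linForm L (drift a Ω) (potential L λ Ω) v v′ φ φ₁ − ∫ w·(λχ·v + Ω·Hv − aΩ₁·𝒰_v)·φ = −∫ w·v·φ`
  (the bracket is `PopFun` of `SheetRAssemblyOperators` at the centre `Ω`, `Ω₁ = Ω′` a.e.; the `λχ` terms cancel, so `λ` is free).
The packaging in selfsim's predicates (`IsCentre`/`PopC`/`IsWeakImage`/`IsWeakEigen`) is part 2, `SheetRTimeShiftModeWeakEigen.lean`.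
No definition, no named fact, no `Prop` hypothesis beyond selfsim's structures. WHAT THIS IS NOT: not NS; not the spectral certificate;
no number of record moves.
-/

noncomputable section

namespace Summit.NavierStokesRegularity.OSWSelfSimilar
namespace SheetRTimeShiftModeWeak

open _root_.MeasureTheory _root_.Set _root_.Filter _root_.Real Literature.Analysis.Fourier SheetRWeakProfilePV SheetRWeakToStrong
  SheetREnergyClass SheetRWeightedMeasure SheetREnergySpace SheetRLinearisedTests SheetRTestSpace SheetRLinearisedFormBounds
  SheetRSolutionOperator SheetRAssemblyOperators SheetRCertificateAssembly
open scoped Topology ENNReal ContDiff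

/-! ### §1 Integration by parts against a compactly supported test -/

/-- **`∫ g′·φ = −∫ g·φ₁`** for `g ∈ C¹` and a compactly supported odd energy-class test `(φ, φ₁)` (`φ = ∫₀φ₁` absolutely continuous,
`φ′ = φ₁` a.e., boundary terms vanish). [folklore] -/
theorem integral_deriv_mul_test {g φ φ₁ : ℝ → ℝ} (hg : ContDiff ℝ 1 g) (hφ : IsCompactTest φ φ₁) :
    ∫ y, deriv g y * φ y = -∫ y, g y * φ₁ y := by
  obtain ⟨hc, -, -, -⟩ := basic_of_isCompactTest hφ
  obtain ⟨R, hR⟩ := hφ.support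
  have hii : ∀ a b, IntervalIntegrable φ₁ volume a b := intervalIntegrable_of_memLp_two hφ.memLp
  set R' : ℝ := |R| + 1 with hR'
  have hR'pos : 0 < R' := by positivity
  have hvan : ∀ x, R' ≤ |x| → φ x = 0 ∧ φ₁ x = 0 := fun x hx => hR x (by linarith [le_abs_self R])
  have hφac : AbsolutelyContinuousOnInterval φ (-R') R' := absolutelyContinuousOnInterval_of_primitive hφ.primitive hii _ _
  have hgac : AbsolutelyContinuousOnInterval g (-R') R' := hg.contDiffOn.absolutelyContinuousOnInterval
  have hibp := hgac.integral_mul_deriv_eq_deriv_mul hφac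
  have hva : φ (-R') = 0 := (hvan _ (by rw [abs_neg, abs_of_pos hR'pos])).1
  have hvb : φ R' = 0 := (hvan _ (by rw [abs_of_pos hR'pos])).1
  simp only [hva, hvb, mul_zero, sub_zero, zero_sub] at hibp
  -- `deriv φ = φ₁` a.e.
  have hder : ∀ᵐ y : ℝ, HasDerivAt φ (φ₁ y) y := by
    filter_upwards [_root_.LocallyIntegrable.ae_hasDerivAt_integral (hφ.memLp.locallyIntegrable one_le_two)] with y hy
    have e : φ = fun x => φ 0 + ∫ s in (0 : ℝ)..x, φ₁ s := funext hφ.primitive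
    rw [e]
    exact (hy 0).const_add _
  have hcongr : ∫ y in (-R')..R', g y * deriv φ y = ∫ y in (-R')..R', g y * φ₁ y :=
    intervalIntegral.integral_congr_ae (hder.mono fun y hy _ => by rw [hy.deriv])
  have hout : ∀ y, y ∉ Ioc (-R') R' → R' ≤ |y| := by
    intro y hy
    simp only [mem_Ioc, not_and_or, not_lt, not_le] at hy
    rcases hy with h | h
    · rw [abs_of_nonpos (by linarith)]; linarith
    · rw [abs_of_pos (by linarith)]; exact h.le
  have hsupp1 : Function.support (fun y => deriv g y * φ y) ⊆ Ioc (-R') R' := by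
    intro y hy
    rw [Function.mem_support] at hy
    by_contra hy'
    exact hy (by rw [(hvan y (hout y hy')).1, mul_zero])
  have hsupp2 : Function.support (fun y => g y * φ₁ y) ⊆ Ioc (-R') R' := by
    intro y hy
    rw [Function.mem_support] at hy
    by_contra hy'
    exact hy (by rw [(hvan y (hout y hy')).2, mul_zero])
  rw [← intervalIntegral.integral_eq_integral_of_support_subset hsupp1,
    ← intervalIntegral.integral_eq_integral_of_support_subset hsupp2, ← hcongr]
  linarith

/-! ### §2 Odd energy-class profiles as elements of the energy space -/

variable {L : ℝ}

/-- **An odd energy-class profile is an energy-space element.** For `v = ∫₀v₁` odd with `v₁` a.e.-strongly measurable and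
`∫ w v² < ∞`, `∫ w v₁² < ∞` there is `P ∈ Esp L hL` with `prim (der P) = v` (everywhere) and `der P = v₁` a.e. [folklore] -/
theorem exists_esp_of_profile (hL : 0 < L) {v v₁ : ℝ → ℝ} (hv : ∀ x, v x = ∫ s in (0 : ℝ)..x, v₁ s)
    (hodd : ∀ y, v (-y) = -v y) (hv₁m : AEStronglyMeasurable v₁ volume)
    (hw0 : Integrable fun y => (L ^ 2 + y ^ 2) * v y ^ 2) (hw1 : Integrable fun y => (L ^ 2 + y ^ 2) * v₁ y ^ 2) :
    ∃ P : Esp L hL, prim (der P) = v ∧ der P =ᵐ[volume] v₁ := by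
  have hv' : ∀ x, v x = v 0 + ∫ s in (0 : ℝ)..x, v₁ s := fun x => by
    rw [hv x, hv 0, intervalIntegral.integral_same, zero_add]
  have hv₁2 : MemLp v₁ 2 volume := memLp_two_of_weighted_sq hL hv₁m hw1
  have hvc : Continuous v := continuous_of_primitive hv' (intervalIntegrable_of_memLp_two hv₁2)
  set a : W L := (memLp_W hvc.aestronglyMeasurable hw0).toLp v with ha
  set b : W L := (memLp_W hv₁m hw1).toLp v₁ with hb
  have hae_a : (a : ℝ → ℝ) =ᵐ[volume] v := ae_volume_of_ae_μw hL (MemLp.coeFn_toLp _)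
  have hae_b : (b : ℝ → ℝ) =ᵐ[volume] v₁ := ae_volume_of_ae_μw hL (MemLp.coeFn_toLp _)
  have hprimb : prim (b : ℝ → ℝ) = v := by
    rw [prim_congr_ae hae_b]; funext x; rw [prim_apply, hv x]
  have hmem : WithLp.toLp 2 (((1 / 2 : ℝ) • a), b) ∈ Esp L hL := by
    have hfst : ((WithLp.toLp 2 (((1 / 2 : ℝ) • a), b)).fst : ℝ → ℝ) =ᵐ[volume] fun y => (1 / 2) * v y := by
      have h1 : (((1 / 2 : ℝ) • a : W L) : ℝ → ℝ) =ᵐ[volume] fun y => (1 / 2) * (a : ℝ → ℝ) y :=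
        (ae_volume_of_ae_μw hL (Lp.coeFn_smul (1 / 2 : ℝ) a)).mono fun y hy => by rw [hy, Pi.smul_apply, smul_eq_mul]
      exact h1.trans (hae_a.mono fun y hy => by simp only [hy])
    rw [mem_Esp_iff]
    have hsnd : (WithLp.toLp 2 (((1 / 2 : ℝ) • a), b)).snd = b := rfl
    refine ⟨fun x => ?_, fun x => ?_⟩
    · rw [hsnd, hprimb]
      have hcongr : ∫ s in (0 : ℝ)..x, (2 * ((WithLp.toLp 2 (((1 / 2 : ℝ) • a), b)).fst : ℝ → ℝ) s - v s) =
          ∫ s in (0 : ℝ)..x, (0 : ℝ) :=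
        intervalIntegral.integral_congr_ae (hfst.mono fun y hy _ => by rw [hy]; ring)
      rw [hcongr, intervalIntegral.integral_zero]
    · rw [hsnd, hprimb]
      exact hodd x
  refine ⟨⟨_, hmem⟩, ?_, ?_⟩
  · show prim (((WithLp.toLp 2 (((1 / 2 : ℝ) • a), b)).snd : W L) : ℝ → ℝ) = v
    exact hprimb
  · show (((WithLp.toLp 2 (((1 / 2 : ℝ) • a), b)).snd : W L) : ℝ → ℝ) =ᵐ[volume] v₁
    exact hae_b

/-- If `prim (der P) = v` and `v X ≠ 0` for some `X`, then `P ≠ 0`. [folklore] -/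
theorem esp_ne_zero_of_apply_ne_zero (hL : 0 < L) {P : Esp L hL} {v : ℝ → ℝ} (hP : prim (der P) = v) {X : ℝ} (hX : v X ≠ 0) :
    P ≠ 0 := by
  rintro rfl
  apply hX
  have h0 : der (0 : Esp L hL) =ᵐ[volume] (0 : ℝ → ℝ) := by
    rw [der_def, Submodule.coe_zero, WithLp.zero_snd]
    exact ae_volume_of_ae_μw hL (Lp.coeFn_zero _ _ _)
  rw [← hP, prim_congr_ae h0]
  simp [prim]


/-! ### §3 STRONG ⇒ WEAK for the linearised equation at a centre -/

/-- A compactly supported test has compact support (as a function), and so does every product with it. [folklore] -/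
theorem hasCompactSupport_of_isCompactTest {φ φ₁ : ℝ → ℝ} (hφ : IsCompactTest φ φ₁) : HasCompactSupport φ := by
  obtain ⟨R, hR⟩ := hφ.support
  refine HasCompactSupport.intro (isCompact_Icc : IsCompact (Icc (-|R|) |R|)) fun x hx => ?_
  have : R ≤ |x| := by
    simp only [mem_Icc, not_and_or, not_le] at hx
    rcases hx with hx | hx
    · linarith [le_abs_self R, neg_abs_le x, abs_nonneg R, show |x| ≥ -x from neg_le_abs x]
    · linarith [le_abs_self R, le_abs_self x]
  exact (hR x this).1

/-- **STRONG ⇒ WEAK.** Let `v ∈ C²` with finite weights `∫ w v², ∫ w v′² < ∞`, and suppose the pointwise linearised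
equation of the profile map at `Ω`, tested on `v`, with eigenvalue `−1`:
`v + ½ξv′ + a(𝒰_v·Ω′ + 𝒰_Ω·v′) − Hv·Ω − HΩ·v − v″ = −v` (`𝒰_f = ∫₀Hf`). Then for every compactly supported test `(φ, φ₁)` and
every `λ`, with the coefficients of record `d = drift a Ω = ½ξ + a𝒰_Ω`, `V = potential L λ Ω = 1 − HΩ + λχ` (any measurable `Ω₁` with
`Ω₁ = Ω′` a.e. in the nonlocal term, any coefficient bounds making the weak form integrable):
`linForm L d V v v′ φ φ₁ − ∫ w·(λχ·v + Ω·Hv − a·Ω₁·𝒰_v)·φ = −∫ w·v·φ` — one integration by parts of `−v″` against `wφ`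
(`(wφ)′ = 2ξφ + wφ₁`). MODEL statement; not NS. [folklore] -/
theorem linForm_sub_pop_eq_of_strong (hL : 0 < L) (lam a : ℝ) {Ω Ω₁ v : ℝ → ℝ} {D₀ V₀ : ℝ}
    (hΩ₁ : Ω₁ =ᵐ[volume] deriv Ω)
    (hdm : AEStronglyMeasurable (drift a Ω) volume) (hVm : AEStronglyMeasurable (potential L lam Ω) volume)
    (hd : ∀ ξ, |drift a Ω ξ| ≤ D₀ + 1 / 2 * |ξ|) (hV : ∀ ξ, |potential L lam Ω ξ| ≤ V₀)
    (hv : ContDiff ℝ 2 v) (hvw0 : Integrable fun y => (L ^ 2 + y ^ 2) * v y ^ 2)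
    (hvw1 : Integrable fun y => (L ^ 2 + y ^ 2) * deriv v y ^ 2)
    (hstrong : ∀ X, v X + 1 / 2 * X * deriv v X
        + a * ((∫ s in (0 : ℝ)..X, hilbertTransform v s) * deriv Ω X + (∫ s in (0 : ℝ)..X, hilbertTransform Ω s) * deriv v X)
        - hilbertTransform v X * Ω X - hilbertTransform Ω X * v X - iteratedDeriv 2 v X = -v X)
    (hPint : ∀ {φ φ₁ : ℝ → ℝ}, IsCompactTest φ φ₁ → Integrable fun y => (L ^ 2 + y ^ 2) *
        ((lam * (L ^ 2 / (L ^ 2 + y ^ 2)) * v y + Ω y * hilbertTransform v y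
          - a * Ω₁ y * ∫ s in (0 : ℝ)..y, hilbertTransform v s) * φ y))
    {φ φ₁ : ℝ → ℝ} (hφ : IsCompactTest φ φ₁) :
    linForm L (drift a Ω) (potential L lam Ω) v (deriv v) φ φ₁
        - ∫ y, (L ^ 2 + y ^ 2) * ((lam * (L ^ 2 / (L ^ 2 + y ^ 2)) * v y + Ω y * hilbertTransform v y
            - a * Ω₁ y * ∫ s in (0 : ℝ)..y, hilbertTransform v s) * φ y) =
      -∫ y, (L ^ 2 + y ^ 2) * (v y * φ y) := by
  obtain ⟨hφc, -, -, B, hB0, hB⟩ := basic_of_isCompactTest hφ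
  have hφK := hasCompactSupport_of_isCompactTest hφ
  have hvc : Continuous v := hv.continuous
  have hv1 : ContDiff ℝ 1 (deriv v) := (contDiff_succ_iff_deriv.1 hv).2.2
  have hv'c : Continuous (deriv v) := hv1.continuous
  have hv''c : Continuous (deriv (deriv v)) := hv1.continuous_deriv le_rfl
  have hd1 : ∀ y, HasDerivAt (deriv v) (deriv (deriv v) y) y := fun y =>
    ((hv1.differentiable one_ne_zero) y).hasDerivAt
  have hit : ∀ y, iteratedDeriv 2 v y = deriv (deriv v) y := fun y => by
    rw [show (2 : ℕ) = 1 + 1 from rfl, iteratedDeriv_succ, iteratedDeriv_one]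
  -- the multiplier `g = w·v′ ∈ C¹` and its derivative
  set g : ℝ → ℝ := fun y => (L ^ 2 + y ^ 2) * deriv v y with hg
  have hgC : ContDiff ℝ 1 g := by rw [hg]; exact (by fun_prop : ContDiff ℝ 1 fun y : ℝ => L ^ 2 + y ^ 2).mul hv1
  have hgd : ∀ y, deriv g y = 2 * y * deriv v y + (L ^ 2 + y ^ 2) * deriv (deriv v) y := by
    intro y
    have hw : HasDerivAt (fun y : ℝ => L ^ 2 + y ^ 2) (2 * y) y := by
      have := ((hasDerivAt_id y).pow 2).const_add (L ^ 2)
      simpa using this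
    have h : HasDerivAt (fun y => (L ^ 2 + y ^ 2) * deriv v y) (2 * y * deriv v y + (L ^ 2 + y ^ 2) * deriv (deriv v) y) y :=
      hw.mul (hd1 y)
    rw [hg, h.deriv]
  -- (A) integration by parts: `∫ (2ξv′ + wv″)·φ = −∫ w v′ φ₁`
  have hA := integral_deriv_mul_test hgC hφ
  -- integrability of the weak-form integrand, the `P`-term, the pivot term and the boundary integrand
  obtain ⟨hI, -⟩ := abs_linForm_le (d := drift a Ω) (V := potential L lam Ω) hL hdm hVm (by norm_num : (0:ℝ) ≤ 1 / 2) hd hV hφ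
    hvc.aestronglyMeasurable hv'c.aestronglyMeasurable hvw0 hvw1
  have hP := hPint hφ
  have hVw : Integrable fun y => (L ^ 2 + y ^ 2) * (v y * φ y) := by
    have e : (fun y => (L ^ 2 + y ^ 2) * (v y * φ y)) = fun y => ((L ^ 2 + y ^ 2) * v y) * φ y := by
      funext y; ring
    rw [e]
    exact Continuous.integrable_of_hasCompactSupport (by fun_prop) hφK.mul_left
  have hG2 : Integrable fun y => deriv g y * φ y :=
    Continuous.integrable_of_hasCompactSupport ((hgC.continuous_deriv le_rfl).mul hφc) hφK.mul_left
  -- (B) the pointwise identity, a.e. (where `Ω₁ = Ω′`)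
  have hB : ∀ᵐ y : ℝ,
      ((L ^ 2 + y ^ 2) * (deriv v y * φ₁ y) + 2 * y * (deriv v y * φ y) + (L ^ 2 + y ^ 2) * drift a Ω y * (deriv v y * φ y)
          + (L ^ 2 + y ^ 2) * potential L lam Ω y * (v y * φ y))
        - (L ^ 2 + y ^ 2) * ((lam * (L ^ 2 / (L ^ 2 + y ^ 2)) * v y + Ω y * hilbertTransform v y
            - a * Ω₁ y * ∫ s in (0 : ℝ)..y, hilbertTransform v s) * φ y)
        + (L ^ 2 + y ^ 2) * (v y * φ y) =
      (L ^ 2 + y ^ 2) * deriv v y * φ₁ y + deriv g y * φ y := by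
    filter_upwards [hΩ₁] with y hy
    have hs := hstrong y
    rw [hit y] at hs
    rw [hy, hgd y]
    unfold drift potential
    have hE : v y + 1 / 2 * y * deriv v y
        + a * ((∫ s in (0 : ℝ)..y, hilbertTransform v s) * deriv Ω y + (∫ s in (0 : ℝ)..y, hilbertTransform Ω s) * deriv v y)
        - hilbertTransform v y * Ω y - hilbertTransform Ω y * v y + v y = deriv (deriv v) y := by linarith
    rw [← hE]
    ring
  -- (C) integrate
  have hG1 : Integrable fun y => (L ^ 2 + y ^ 2) * deriv v y * φ₁ y := by
    have h := ((hI.sub hP).add hVw).sub hG2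
    refine h.congr ?_
    filter_upwards [hB] with y hy
    simp only [Pi.sub_apply, Pi.add_apply] at hy ⊢
    linarith
  have hlin : linForm L (drift a Ω) (potential L lam Ω) v (deriv v) φ φ₁ =
      ∫ y, ((L ^ 2 + y ^ 2) * (deriv v y * φ₁ y) + 2 * y * (deriv v y * φ y) + (L ^ 2 + y ^ 2) * drift a Ω y * (deriv v y * φ y)
          + (L ^ 2 + y ^ 2) * potential L lam Ω y * (v y * φ y)) := rfl
  have eB := integral_congr_ae hB
  have eL : (∫ y, ((L ^ 2 + y ^ 2) * (deriv v y * φ₁ y) + 2 * y * (deriv v y * φ y) + (L ^ 2 + y ^ 2) * drift a Ω y * (deriv v y * φ y)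
          + (L ^ 2 + y ^ 2) * potential L lam Ω y * (v y * φ y))
        - (L ^ 2 + y ^ 2) * ((lam * (L ^ 2 / (L ^ 2 + y ^ 2)) * v y + Ω y * hilbertTransform v y
            - a * Ω₁ y * ∫ s in (0 : ℝ)..y, hilbertTransform v s) * φ y)
        + (L ^ 2 + y ^ 2) * (v y * φ y)) =
      (∫ y, ((L ^ 2 + y ^ 2) * (deriv v y * φ₁ y) + 2 * y * (deriv v y * φ y) + (L ^ 2 + y ^ 2) * drift a Ω y * (deriv v y * φ y)
          + (L ^ 2 + y ^ 2) * potential L lam Ω y * (v y * φ y)))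
        - (∫ y, (L ^ 2 + y ^ 2) * ((lam * (L ^ 2 / (L ^ 2 + y ^ 2)) * v y + Ω y * hilbertTransform v y
            - a * Ω₁ y * ∫ s in (0 : ℝ)..y, hilbertTransform v s) * φ y))
        + (∫ y, (L ^ 2 + y ^ 2) * (v y * φ y)) := by
    rw [integral_add _ hVw, integral_sub hI hP]
    exact hI.sub hP
  have eR := integral_add hG1 hG2
  have hgφ : ∫ y, g y * φ₁ y = ∫ y, (L ^ 2 + y ^ 2) * deriv v y * φ₁ y := rfl
  rw [hlin]
  linarith

end SheetRTimeShiftModeWeak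
end Summit.NavierStokesRegularity.OSWSelfSimilar

end
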